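import Literature.AlgebraicGeometry.GroupSchemes.KernelIdealSpecialFibre
import Literature.AlgebraicGeometry.GroupSchemes.EtaleHopfIdealsOfPoints
import Literature.AlgebraicGeometry.GroupSchemes.IdealKernelLayerMap
import Mathlib.RingTheory.Ideal.GoingUp
import Mathlib.FieldTheory.IsAlgClosed.Basic
import HarnessLib

/-!
# Points of the schematic image of a finite scheme are image points; the image ideal of a homomorphism into a finite étale group is
# the ideal of the image points; kills-statements and layer maps transport along morphisms
# ([StacksProject] 00U3, 01R8; [Tate1997FiniteFlatGroupSchemes] (1.6)–(1.7), (3.7); [Waterhouse1979] §2.1)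

Topic `Literature/AlgebraicGeometry/GroupSchemes`; namespaces `Literature.AlgebraicGeometry.GroupSchemes.AffineGroupScheme` (§1–§3) and
`Literature.AlgebraicGeometry.GroupSchemes.IdealKernelLayerMap` (§4).  THEOREMS ONLY (no definition, no instance, no notation, no named fact, no
`sorry`).  Cell `hodgecm-mathlib` (D-0151), programme P6 «MOD» (crux hLiu418 = stmt-HodgeConjecture-24832, `--supports`, count-neutral): generic
organs (G1) ∕ (G2) ∕ (G3) of line L2 organ (O1) `stub_SPEC` («the `e`-sheet readings with their laws», D-line `stub_DOWN`), KERNEL-IDEAL SPECIALISATION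
road (LA2-plan deal 2026-09-02T02:06Z; LA2-p02 census 02:10Z):
* (G3) is the UPSTAIRS input of (H4′) «backtracking line = image line» in Hopf-ideal currency: the line `L_b ⊂ A_{y′}[𝔭](Ω̄)` is a subgroup of POINTS,
  its ideal is the ★ points ideal `ker (AlgHom.pi ptEquiv)` (`HopfIdealOfFiniteSubgroupOfPoints`), while ★ (SP-img) `ImageIdealSpecialFibre` specialises
  the IMAGE IDEAL `ker Γ(φ_K)`; §3 says they agree when `L_b` = the image points (finite étale target over an algebraically closed field);
* (G1) moves the kills-statement delivered by ★ (O-K) `quotIncl_spI_comp_eq_one` across the dock identification `𝒢_κ ≅ G₀ x̄` (any morphism, in fact);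
* (G2) is the 4-object naturality of the ★ layer map (`IdealKernelLayerMap` L3 is the endomorphism case), so that the layer map read on the dock՚s pins is
  conjugate to the base change of the integral layer map.
HC_CM is proved only modulo the printed citations until rung 0 closes; this file is generic and changes no count.

THE MATHEMATICS.  (§1) For `φ : G → G′`, `ψ : G′ → G″` morphisms of affine `R`-schemes (`G″` a group) and an ideal `I ⊂ Γ(G)`: `ψ` kills the closed
subscheme `V(Γ(φ)⁻¹ I) ↪ G′` iff `ψ` kills `V(I) ↪ G → G′` — both say `J(ψ)·Γ(φ) ≤ I` for the kernel ideal `J(ψ) = Γ(ψ)(Γ(G″)⁺)·Γ(G′)` (★ kills criterion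
`quotIncl_comp_eq_one_iff_map_ker_counit_le`, Mathlib `Ideal.map_le_iff_le_comap`).  (§2) [StacksProject 01R8 + lying over] For `G` FINITE over an
algebraically closed field `k`, `G′` affine and `φ : G → G′`: a `k`-point `x′` of `G′` lies on the schematic image `V(ker Γ(φ))` iff `x′ = x ≫ φ` for a
`k`-point `x` of `G` — the character `χ′` of `x′` factors through `Γ(G′)⧸ker Γ(φ) ↪ Γ(G)`, which is module-finite; a maximal ideal of `Γ(G)` lies over
`ker χ̄′` (Mathlib `Ideal.exists_ideal_over_maximal_of_isIntegral`) and has residue field `k` (Mathlib `IsAlgClosed.algebraMap_bijective_of_isIntegral`).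
(§3) [StacksProject 00U3] Hence if moreover `G′` is ÉTALE, the image ideal `ker Γ(φ)` — like every ideal of `Γ(G′)` the ideal of its points (★
`EtaleIdealPoints.eq_ker_pi_ptEquiv_points`) — is the ideal `ker (χ_{x ≫ φ})_x` of the family of image points.  (§4) [Tate (1.6)–(1.7)] Layer maps are
natural: for pins `ιA, ιB, ιA′, ιB′` (`ιB′` mono), `ψ : A → B`, `ψ′ : A′ → B′`, layer maps `φ` over `ψ` and `φ′` over `ψ′`, and morphisms `a, b, ga, gb`
with `a ≫ ψ′ = ψ ≫ b`, `ga ≫ ιA′ = ιA ≫ a`, `gb ≫ ιB′ = ιB ≫ b`: `ga ≫ φ′ = φ ≫ gb` (cancel `ιB′`).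

* §1 **`quotIncl_comap_comp_eq_one_iff`** (G1);
* §2 `exists_algHom_comp_eq_of_ker_le` (algebra core), `ker_comap_le_ker_ptEquiv_comp`, **`exists_comp_eq_of_ker_comap_le_ker_ptEquiv`**,
  **`ker_comap_le_ker_ptEquiv_iff_exists_comp_eq`**;
* §3 **`ker_comap_eq_ker_pi_ptEquiv_comp`** (G3);
* §4 **`IdealKernelLayerMap.comp_eq_comp_of_comp_eq₄`** (G2).

## References
* [StacksProject] The Stacks Project, Tags 00U3 (étale algebras over fields), 01R8 (scheme-theoretic image), 00GU (lying over).
* [Tate1997FiniteFlatGroupSchemes] J. Tate, *Finite flat group schemes* (1997), (1.6)–(1.7) p. 122, (3.7).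
* [Waterhouse1979] W. C. Waterhouse, *Introduction to Affine Group Schemes*, GTM 66 (1979), §2.1 (p. 14).
* [GortzWedhorn2020] U. Görtz, T. Wedhorn, *Algebraic Geometry I*, 2nd ed. (2020), (4.15), Definition 4.45 (2) (p. 117); §(10.8) Definition 10.29 (p. 262).
-/

set_option autoImplicit false

set_option backward.isDefEq.respectTransparency false

universe u

open CategoryTheory CategoryTheory.Limits AlgebraicGeometry MonoidalCategory CartesianMonoidalCategory

noncomputable section

namespace Literature.AlgebraicGeometry.GroupSchemes

namespace AffineGroupScheme

open scoped MonObj CategoryTheory.Obj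

open Literature.AlgebraicGeometry.Motives GroupSchemeKernel

/-! ## §1 (G1) Kills-statements transport along a morphism -/

section Kills

variable {R : Type u} [CommRing R] {G G' G'' : SchemeOver R} [GrpObj G'] [GrpObj G''] [IsAffine G.left] [IsAffine G'.left] [IsAffine G''.left]

omit [GrpObj G'] in
/-- **(G1) KILLS TRANSPORT**: for `φ : G → G′`, `ψ : G′ → G″` (`G″` a group) and an ideal `I ⊂ Γ(G)`, `ψ` kills the closed subscheme
`V(Γ(φ)⁻¹ I) ↪ G′` iff `ψ` kills `V(I) ↪ G` after `φ` — both sides are `J(ψ)·Γ(φ) ≤ I` (★ `quotIncl_comp_eq_one_iff_map_ker_counit_le`, ★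
`Alg.comap_comp`, Mathlib `Ideal.map_map` ∕ `Ideal.map_le_iff_le_comap`).  With `φ` the dock identification `G₀ x̄ ⥲ 𝒢_κ` this moves ★ (O-K)
`quotIncl_spI_comp_eq_one` onto the dock՚s carrier `AdmSub (G₀ x̄)`. [cite: Waterhouse1979, §2.1 (p. 14)] [cite: GortzWedhorn2020, Definition 4.45 (2) (p. 117)] -/
theorem quotIncl_comap_comp_eq_one_iff (φ : G ⟶ G') (ψ : G' ⟶ G'') (I : Ideal (Alg G)) :
    quotIncl G' (I.comap φ.left.appTop.hom) ≫ ψ = 1 ↔ quotIncl G I ≫ φ ≫ ψ = 1 := by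
  rw [quotIncl_comp_eq_one_iff_map_ker_counit_le, quotIncl_comp_eq_one_iff_map_ker_counit_le, Alg.comap_comp,
    Ideal.map_le_iff_le_comap, Ideal.map_le_iff_le_comap]
  exact Iff.rfl

end Kills

/-! ## §2 Points of the schematic image of a finite scheme over an algebraically closed field -/

section ImagePoints

/-- **ALGEBRA CORE — characters extend along module-finite maps over an algebraically closed field**: for `k`-algebras `B →ᶠ A` with `A`
module-finite over `k` (`k` algebraically closed) and a character `χ′ : B → k` killing `ker f`, there is a character `χ : A → k` with `χ′ = χ ∘ f`:
`ker χ′` is maximal and contains `ker f`, a maximal ideal `Q` of `A` lies over it (Mathlib `Ideal.exists_ideal_over_maximal_of_isIntegral`, `A` integral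
over `B`), and `k → A ⧸ Q` is bijective (Mathlib `IsAlgClosed.algebraMap_bijective_of_isIntegral`). [cite: StacksProject, Tag 00GU] -/
theorem exists_algHom_comp_eq_of_ker_le {k A B : Type u} [Field k] [IsAlgClosed k] [CommRing A] [Algebra k A] [CommRing B] [Algebra k B]
    [Module.Finite k A] (f : B →ₐ[k] A) (χ' : B →ₐ[k] k) (hχ' : RingHom.ker f.toRingHom ≤ RingHom.ker χ'.toRingHom) :
    ∃ χ : A →ₐ[k] k, χ' = χ.comp f := by
  letI : Algebra B A := f.toRingHom.toAlgebra
  haveI : IsScalarTower k B A := IsScalarTower.of_algebraMap_eq fun r => (f.commutes r).symm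
  haveI : Module.Finite B A := Module.Finite.of_restrictScalars_finite k B A
  haveI : Algebra.IsIntegral B A := Algebra.IsIntegral.of_finite B A
  haveI hmax : (RingHom.ker χ'.toRingHom).IsMaximal :=
    RingHom.ker_isMaximal_of_surjective χ'.toRingHom fun r => ⟨algebraMap k B r, χ'.commutes r⟩
  obtain ⟨Q, hQ, hQP⟩ := Ideal.exists_ideal_over_maximal_of_isIntegral (S := A) (RingHom.ker χ'.toRingHom) hχ'
  haveI := hQ
  haveI : Module.Finite k (A ⧸ Q) := Module.Finite.of_surjective (Ideal.Quotient.mkₐ k Q).toLinearMap (Ideal.Quotient.mkₐ_surjective k Q)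
  haveI : Algebra.IsIntegral k (A ⧸ Q) := Algebra.IsIntegral.of_finite k (A ⧸ Q)
  have hbij : Function.Bijective (Algebra.ofId k (A ⧸ Q)) := IsAlgClosed.algebraMap_bijective_of_isIntegral (k := k) (K := A ⧸ Q)
  let e : k ≃ₐ[k] A ⧸ Q := AlgEquiv.ofBijective (Algebra.ofId k (A ⧸ Q)) hbij
  refine ⟨e.symm.toAlgHom.comp (Ideal.Quotient.mkₐ k Q), ?_⟩
  -- two characters of `B` whose kernels are nested are equal
  have hker : ∀ b, χ' b = 0 → (e.symm.toAlgHom.comp (Ideal.Quotient.mkₐ k Q)) (f b) = 0 := by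
    intro b hb
    have hbQ : f b ∈ Q := by
      have : b ∈ Q.comap (algebraMap B A) := by rw [hQP]; exact hb
      exact this
    rw [AlgHom.comp_apply, Ideal.Quotient.mkₐ_eq_mk, Ideal.Quotient.eq_zero_iff_mem.mpr hbQ, map_zero]
  apply AlgHom.ext
  intro b
  have h1 : χ' (b - algebraMap k B (χ' b)) = 0 := by rw [map_sub, AlgHom.commutes, Algebra.algebraMap_self_apply, sub_self]
  have h2 := hker _ h1
  rw [map_sub, map_sub, AlgHom.commutes, AlgHom.commutes, Algebra.algebraMap_self_apply, sub_eq_zero] at h2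
  rw [AlgHom.comp_apply]
  exact h2.symm

variable {k : Type u} [Field k] {G G' : SchemeOver k} [IsAffine G.left] [IsAffine G'.left] (φ : G ⟶ G')

/-- Image points lie on the schematic image: `ker Γ(φ) ≤ ker χ_{x ≫ φ}` (★ `ptEquiv_comp`). [cite: StacksProject, Tag 01R8] -/
theorem ker_comap_le_ker_ptEquiv_comp (x : Motives.specOver k k ⟶ G) :
    RingHom.ker (Alg.comap φ).toRingHom ≤ RingHom.ker (ptEquiv G' k (x ≫ φ)).toRingHom := by
  intro a ha
  rw [RingHom.mem_ker] at ha ⊢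
  change ptEquiv G' k (x ≫ φ) a = 0
  rw [ptEquiv_comp, AlgHom.comp_apply]
  change ptEquiv G k x ((Alg.comap φ).toRingHom a) = 0
  rw [ha, map_zero]

/-- **POINTS OF THE SCHEMATIC IMAGE OF A FINITE SCHEME ARE IMAGE POINTS**: for `G` finite over an algebraically closed field `k`, `G′` affine and
`φ : G → G′`, every `k`-point `x′` of `G′` on `V(ker Γ(φ))` is `x ≫ φ` for a `k`-point `x` of `G` (§2 core with `f := Γ(φ)`, ★ `Alg.moduleFinite`, ★
`ptEquiv`, ★ `ptEquiv_comp`). [cite: StacksProject, Tag 01R8] [cite: StacksProject, Tag 00GU] -/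
theorem exists_comp_eq_of_ker_comap_le_ker_ptEquiv [IsAlgClosed k] [IsFinite G.hom] (x' : Motives.specOver k k ⟶ G')
    (h : RingHom.ker (Alg.comap φ).toRingHom ≤ RingHom.ker (ptEquiv G' k x').toRingHom) :
    ∃ x : Motives.specOver k k ⟶ G, x ≫ φ = x' := by
  haveI : Module.Finite k (Alg G) := Alg.moduleFinite G
  obtain ⟨χ, hχ⟩ := exists_algHom_comp_eq_of_ker_le (Alg.comap φ) (ptEquiv G' k x') h
  refine ⟨(ptEquiv G k).symm χ, (ptEquiv G' k).injective ?_⟩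
  rw [ptEquiv_comp, Equiv.apply_symm_apply, ← hχ]

/-- **`x′ ∈ V(ker Γ(φ))` iff `x′` is an image point** (`G` finite, `k` algebraically closed). [cite: StacksProject, Tag 01R8] -/
theorem ker_comap_le_ker_ptEquiv_iff_exists_comp_eq [IsAlgClosed k] [IsFinite G.hom] (x' : Motives.specOver k k ⟶ G') :
    RingHom.ker (Alg.comap φ).toRingHom ≤ RingHom.ker (ptEquiv G' k x').toRingHom ↔ ∃ x : Motives.specOver k k ⟶ G, x ≫ φ = x' :=
  ⟨exists_comp_eq_of_ker_comap_le_ker_ptEquiv φ x', fun ⟨x, hx⟩ => hx ▸ ker_comap_le_ker_ptEquiv_comp φ x⟩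

/-! ## §3 (G3) The image ideal of a map into a finite étale scheme is the ideal of the image points -/

/-- **(G3) IMAGE IDEAL = IDEAL OF THE IMAGE POINTS**: for `G` finite and `G′` étale affine over an algebraically closed field `k` and `φ : G → G′`,
`ker Γ(φ)` is the ★ points ideal `ker (χ_{x ≫ φ})_{x ∈ G(k)}` of the family of image points (`⊆`: ★ `ptEquiv_comp`; `⊇`: `ker Γ(φ)` is the ideal of
ITS points, ★ `EtaleIdealPoints.eq_ker_pi_ptEquiv_points`, and those are image points, §2).  Upstairs input of the cell's (H4′): the Hopf ideal of the
image LINE (a subgroup of `Ω̄`-points) is the image ideal that ★ (SP-img) specialises. [cite: StacksProject, Tag 00U3] [cite: Tate1997FiniteFlatGroupSchemes, (3.7)] -/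
theorem ker_comap_eq_ker_pi_ptEquiv_comp [IsAlgClosed k] [IsFinite G.hom] [Etale G'.hom] :
    RingHom.ker (Alg.comap φ).toRingHom =
      RingHom.ker (AlgHom.pi fun x : (Motives.specOver k k ⟶ G) => ptEquiv G' k (x ≫ φ) :
        Alg G' →ₐ[k] ((Motives.specOver k k ⟶ G) → k)).toRingHom := by
  refine le_antisymm (fun a ha => ?_) (fun a ha => ?_)
  · rw [RingHom.mem_ker]
    funext x
    change ptEquiv G' k (x ≫ φ) a = 0
    have h := ker_comap_le_ker_ptEquiv_comp φ x ha
    rwa [RingHom.mem_ker] at h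
  · rw [EtaleIdealPoints.eq_ker_pi_ptEquiv_points G' (RingHom.ker (Alg.comap φ).toRingHom), RingHom.mem_ker]
    rw [RingHom.mem_ker] at ha
    funext x'
    change ptEquiv G' k x'.1 a = 0
    obtain ⟨x, hx⟩ := exists_comp_eq_of_ker_comap_le_ker_ptEquiv φ x'.1 x'.2
    have h := congr_fun ha x
    change ptEquiv G' k (x ≫ φ) a = 0 at h
    rw [hx] at h
    exact h

end ImagePoints

end AffineGroupScheme

/-! ## §4 (G2) Naturality of the layer map (four-object form of ★ L3) -/

namespace IdealKernelLayerMap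

variable {C : Type*} [Category C]

/-- **(G2) LAYER MAPS ARE NATURAL**: pins `ιA : GA → A`, `ιB : GB → B`, `ιA′ : GA′ → A′`, `ιB′ : GB′ → B′` (`ιB′` mono), layer maps `φ` over
`ψ : A → B` (`φ ≫ ιB = ιA ≫ ψ`) and `φ′` over `ψ′ : A′ → B′`, and a morphism of the whole situation — `a : A → A′`, `b : B → B′` with `a ≫ ψ′ = ψ ≫ b`,
lifted to the pins by `ga ≫ ιA′ = ιA ≫ a`, `gb ≫ ιB′ = ιB ≫ b` — give a commuting square of layer maps `ga ≫ φ′ = φ ≫ gb` (cancel the mono `ιB′`; ★ L3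
`comp_eq_comp_of_comp_eq` is the case `A = A′`, `B = B′`).  Read with `a`, `b`, `ga`, `gb` the dock identifications (isomorphisms), the dock՚s layer map
is CONJUGATE to the base change of the integral layer map. [cite: Tate1997FiniteFlatGroupSchemes, (1.6)–(1.7) p. 122] -/
theorem comp_eq_comp_of_comp_eq₄ {A B A' B' GA GB GA' GB' : C} (ιA : GA ⟶ A) (ιB : GB ⟶ B) (ιA' : GA' ⟶ A') (ιB' : GB' ⟶ B') [Mono ιB']
    {ψ : A ⟶ B} {ψ' : A' ⟶ B'} {φ : GA ⟶ GB} {φ' : GA' ⟶ GB'} (hφ : φ ≫ ιB = ιA ≫ ψ) (hφ' : φ' ≫ ιB' = ιA' ≫ ψ')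
    {a : A ⟶ A'} {b : B ⟶ B'} (hab : a ≫ ψ' = ψ ≫ b) {ga : GA ⟶ GA'} (hga : ga ≫ ιA' = ιA ≫ a) {gb : GB ⟶ GB'} (hgb : gb ≫ ιB' = ιB ≫ b) :
    ga ≫ φ' = φ ≫ gb := by
  rw [← cancel_mono ιB', Category.assoc, hφ', ← Category.assoc, hga, Category.assoc, hab, ← Category.assoc, ← hφ, Category.assoc, ← hgb,
    Category.assoc]

/-- **(G2′) the isomorphism case**: with `a`, `b`, `ga`, `gb` isomorphisms as above, `φ′ = ga⁻¹ ≫ φ ≫ gb` — the layer map on the transported pins IS the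
conjugate. [cite: Tate1997FiniteFlatGroupSchemes, (1.6)–(1.7) p. 122] -/
theorem eq_inv_comp_comp_of_comp_eq₄ {A B A' B' GA GB GA' GB' : C} (ιA : GA ⟶ A) (ιB : GB ⟶ B) (ιA' : GA' ⟶ A') (ιB' : GB' ⟶ B') [Mono ιB']
    {ψ : A ⟶ B} {ψ' : A' ⟶ B'} {φ : GA ⟶ GB} {φ' : GA' ⟶ GB'} (hφ : φ ≫ ιB = ιA ≫ ψ) (hφ' : φ' ≫ ιB' = ιA' ≫ ψ')
    {a : A ⟶ A'} {b : B ⟶ B'} (hab : a ≫ ψ' = ψ ≫ b) (ga : GA ≅ GA') (hga : ga.hom ≫ ιA' = ιA ≫ a) {gb : GB ⟶ GB'} (hgb : gb ≫ ιB' = ιB ≫ b) :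
    φ' = ga.inv ≫ φ ≫ gb := by
  rw [Iso.eq_inv_comp, comp_eq_comp_of_comp_eq₄ ιA ιB ιA' ιB' hφ hφ' hab hga hgb]

end IdealKernelLayerMap

end Literature.AlgebraicGeometry.GroupSchemes

end
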